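import Mathlib.Analysis.SpecialFunctions.Log.Deriv
import Literature.Probability.LatticeModels.GlauberDynamicsStrongMixing
import HarnessLib

/-!
# General bounds on the logarithmic Sobolev constant of a discrete spin system
# (Martinelli, Saint-Flour 1997, §3.8: Propositions 3.9–3.11) — PROVED

Topic `Literature/Probability/LatticeModels`; proofs companion of `GlauberDynamicsStrongMixing.lean`
(vocabulary `Glauber.dirichletForm ν V f = ½ ν(|∇_V f|²)`, `Glauber.PoincareIneq`, `Glauber.LogSobolevIneq`).
Everything here is a THEOREM (no named facts): the three «well known results concerning the logarithmic Sobolev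
constant» of [Mar99] §3.8, which that file deliberately did not mint as facts.

Source (held, read; locators = page files of `book:bertoin1999-lectures-probability-theory-statistics`):
[Mar99] F. Martinelli, *Lectures on Glauber dynamics for discrete spin models*, LNM 1717 (1999), §3.8
p0179 L8 – p0180 L12: Proposition 3.9 (`c_s(L_Λ^τ) ≤ [4 + (4‖J‖ + 2 log 2)|Λ|] gap(L_Λ^τ)⁻¹`), Proposition 3.10
(rough logarithmic Sobolev inequality on a finite probability space: `μ(f² log f) ≤ (4 + 2 log μ₀⁻¹) Var(f) +
μ(f²) log √μ(f²)`, `μ₀ = inf_x μ(x)`), Proposition 3.11 (`c_s(ν₁) ≤ ε² c_s(ν₂)` when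
`‖dν₁/dν₂‖_∞ ∨ ‖dν₂/dν₁‖_∞ ≤ ε`, after Holley–Stroock [HS]). [cite: Martinelli1999]

## Contents

* `Glauber.sq_mul_log_le_pointwise` — the pointwise inequality behind Prop 3.10:
  `h² log h ≤ a(h − a) + (4 + 4 log M)(h − a)²` for `0 < h ≤ M`, `0 < a ≤ 1 ≤ M` (the two cases `h < 2a`,
  `h ≥ 2a` of [Mar99]'s sets `A = {|g| < 1}`, `Aᶜ`, `f = μ(f)(1+g)`).
* `Glauber.Martinelli1999_prop3_10` — **Proposition 3.10**, for a probability measure `μ` on a measurable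
  space whose atoms have mass `≥ μ₀` almost surely (`∀ᵐ x, μ₀ ≤ μ{x}`; on a finite set this is
  `μ₀ ≤ inf_x μ(x)`, and it is the form in which finite-volume Gibbs measures on `S^{ℤ^d}` — purely atomic with
  finitely many atoms — satisfy it): for bounded measurable positive `f`,
  `μ(f² log f) ≤ (4 + 2 log μ₀⁻¹) Var(f) + μ(f²) log √μ(f²)`.
* `Glauber.Martinelli1999_prop3_9` — **Proposition 3.9 in abstract form**: a Poincaré inequality with
  constant `g > 0` and atoms `≥ μ₀` give the log-Sobolev inequality with constant `(4 + 2 log μ₀⁻¹)/g`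
  («follows from (3.12), Proposition 3.10, and a trivial estimate on `inf_σ μ_Λ^τ(σ)`» — the trivial estimate
  `μ_Λ^τ(σ) ≥ 2^{−|Λ|} e^{−2‖J‖|Λ|}`, which turns `2 log μ₀⁻¹` into `(4‖J‖ + 2 log 2)|Λ|`, is model
  bookkeeping left to the user).
* `Glauber.Martinelli1999_prop3_11` — **Proposition 3.11**: if `ν₁ ≤ ε ν₂` and `ν₂ ≤ ε ν₁` (setwise; the
  sup-norm density bounds of the source), then `LogSobolevIneq ν₂ V c → LogSobolevIneq ν₁ V (ε² c)`; proof as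
  printed: `Ent_{ν₁}(f²) = min_{a>0} ν₁(f² log f² − f² log a − f² + a)` with a nonnegative integrand [HS],
  bounded by `ε` times the same at `a = ν₂(f²)`, and `ν₂(|∇_V f|²) ≤ ε ν₁(|∇_V f|²)`.
* `Glauber.LogSobolevIneq.poincareIneq` — **`gap(L_V^τ) ≥ c_s(L_V^τ)⁻¹`** ([Mar99] p0171 L31–33, the «well known
  result (see e.g. [SC])» closing the proof of Theorem 3.3 (a); Bauerschmidt–Bodineau–Dagallier 2024 Prop. 2):
  `LogSobolevIneq ν V c → PoincareIneq ν V c⁻¹` for a probability measure, by the test functions `1 + εg` and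
  `ε → 0` (third-order Taylor bound `sq_mul_log_one_add_ge` from Mathlib's logarithmic-series remainder).
-/

open MeasureTheory ProbabilityTheory Finset Filter

noncomputable section

namespace Literature.Probability.LatticeModels

namespace Glauber

/-! ### Proposition 3.10: a rough logarithmic Sobolev inequality from the size of the atoms -/

/-- The scalar inequality `b log(b/a) ≥ b − a` (`a, b > 0`), in the form `b log b − b log a − b + a ≥ 0`
([Mar99] p0180 L9–12, after [HS]). [cite: Martinelli1999, Proposition 3.11] -/
theorem mul_log_sub_nonneg {a b : ℝ} (ha : 0 < a) (hb : 0 ≤ b) :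
    0 ≤ b * Real.log b - b * Real.log a - b + a := by
  rcases hb.eq_or_lt with rfl | hb'
  · simp [ha.le]
  · -- `log (a/b) ≤ a/b - 1`
    have h := Real.log_le_sub_one_of_pos (div_pos ha hb')
    rw [Real.log_div ha.ne' hb'.ne'] at h
    have h2 : b * (Real.log a - Real.log b) ≤ b * (a / b - 1) := mul_le_mul_of_nonneg_left h hb
    have h3 : b * (a / b - 1) = a - b := by field_simp
    linarith

/-- The pointwise inequality of the proof of [Mar99] Prop 3.10: for `0 < h ≤ M`, `0 < a ≤ 1 ≤ M`,
`h² log h ≤ a (h − a) + (4 + 4 log M) (h − a)²` (case `h < 2a`: `log h ≤ log a + (h/a − 1) ≤ g`,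
`h² g = a²(g + 2g² + g³) ≤ a²(g + 3g²)`; case `h ≥ 2a`: `h² log h ≤ h² log M ≤ 4(h − a)² log M`).
[cite: Martinelli1999, Proposition 3.10] -/
theorem sq_mul_log_le_pointwise {h a M : ℝ} (hh : 0 < h) (hhM : h ≤ M) (ha : 0 < a) (ha1 : a ≤ 1)
    (hM : 1 ≤ M) : h ^ 2 * Real.log h ≤ a * (h - a) + (4 + 4 * Real.log M) * (h - a) ^ 2 := by
  have hlogM : 0 ≤ Real.log M := Real.log_nonneg hM
  have hsq : 0 ≤ (h - a) ^ 2 := sq_nonneg _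
  by_cases hcase : h < 2 * a
  · -- case `|g| < 1`
    set g := h / a - 1 with hg
    have hhg : h = a * (1 + g) := by rw [hg]; field_simp; ring
    have hg1 : g < 1 := by
      rw [hg, div_sub_one ha.ne', div_lt_one ha]; linarith
    have hlog : Real.log h ≤ g := by
      have h1 : Real.log h = Real.log a + Real.log (h / a) := by
        rw [Real.log_div hh.ne' ha.ne']; ring
      have h2 : Real.log (h / a) ≤ h / a - 1 := Real.log_le_sub_one_of_pos (div_pos hh ha)
      have h3 : Real.log a ≤ 0 := Real.log_nonpos ha.le ha1
      rw [h1, hg]; linarith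
    have hstep1 : h ^ 2 * Real.log h ≤ h ^ 2 * g := mul_le_mul_of_nonneg_left hlog (sq_nonneg h)
    have hg3 : g ^ 3 ≤ g ^ 2 := by
      have : g ^ 3 = g * g ^ 2 := by ring
      rw [this]; exact (mul_le_of_le_one_left (sq_nonneg g) hg1.le)
    have hstep2 : h ^ 2 * g ≤ a ^ 2 * (g + 3 * g ^ 2) := by
      rw [hhg]
      have : (a * (1 + g)) ^ 2 * g = a ^ 2 * (g + 2 * g ^ 2 + g ^ 3) := by ring
      rw [this]
      exact mul_le_mul_of_nonneg_left (by nlinarith [sq_nonneg g]) (sq_nonneg a)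
    have hid1 : a ^ 2 * g = a * (h - a) := by rw [hhg]; ring
    have hid2 : a ^ 2 * g ^ 2 = (h - a) ^ 2 := by rw [hhg]; ring
    calc h ^ 2 * Real.log h ≤ a ^ 2 * (g + 3 * g ^ 2) := hstep1.trans hstep2
      _ = a * (h - a) + 3 * (h - a) ^ 2 := by rw [mul_add, hid1, ← mul_assoc, mul_comm (a ^ 2) 3, mul_assoc, hid2]
      _ ≤ a * (h - a) + (4 + 4 * Real.log M) * (h - a) ^ 2 := by nlinarith
  · -- case `g ≥ 1`, i.e. `h ≥ 2a`
    rw [not_lt] at hcase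
    have hlog : Real.log h ≤ Real.log M := Real.log_le_log hh hhM
    have h1 : h ^ 2 * Real.log h ≤ h ^ 2 * Real.log M := mul_le_mul_of_nonneg_left hlog (sq_nonneg h)
    have h2 : h ^ 2 ≤ 4 * (h - a) ^ 2 := by nlinarith
    have h3 : h ^ 2 * Real.log M ≤ 4 * (h - a) ^ 2 * Real.log M := mul_le_mul_of_nonneg_right h2 hlogM
    have h4 : 0 ≤ a * (h - a) := mul_nonneg ha.le (by linarith)
    nlinarith

variable {Ω : Type*} [MeasurableSpace Ω]

/-- `|y² log y| ≤ C² |log C| + 1` for `0 < y ≤ C` (for `y ≤ 1`, `y² |log y| ≤ y ≤ 1`): the bound making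
`f² log f` integrable for bounded positive `f`. [cite: Martinelli1999, Proposition 3.10] -/
theorem abs_sq_mul_log_le {y C : ℝ} (hy : 0 < y) (hyC : y ≤ C) :
    |y ^ 2 * Real.log y| ≤ C ^ 2 * |Real.log C| + 1 := by
  rw [abs_mul, abs_of_nonneg (sq_nonneg y)]
  by_cases hy1 : y ≤ 1
  · have hlog_nonpos : Real.log y ≤ 0 := Real.log_nonpos hy.le hy1
    have habs : |Real.log y| = -Real.log y := abs_of_nonpos hlog_nonpos
    have hb : -Real.log y ≤ y⁻¹ := by
      have := Real.log_le_sub_one_of_pos (inv_pos.2 hy)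
      rw [Real.log_inv] at this
      linarith [inv_pos.2 hy]
    have h3 : y ^ 2 * |Real.log y| ≤ y := by
      rw [habs]
      calc y ^ 2 * -Real.log y ≤ y ^ 2 * y⁻¹ := mul_le_mul_of_nonneg_left hb (sq_nonneg y)
        _ = y := by field_simp
    nlinarith [abs_nonneg (Real.log C), sq_nonneg C]
  · rw [not_le] at hy1
    have hC1 : 1 ≤ C := hy1.le.trans hyC
    have hlogy : 0 ≤ Real.log y := Real.log_nonneg hy1.le
    have hlogC : Real.log y ≤ Real.log C := Real.log_le_log hy hyC
    rw [abs_of_nonneg hlogy, abs_of_nonneg (Real.log_nonneg hC1)]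
    have : y ^ 2 ≤ C ^ 2 := pow_le_pow_left₀ hy.le hyC 2
    nlinarith

/-- `f² log f` is integrable on a finite measure space for bounded measurable positive `f`.
[cite: Martinelli1999, Proposition 3.10] -/
theorem integrable_sq_mul_log (μ : Measure Ω) [IsFiniteMeasure μ] {f : Ω → ℝ} (hm : Measurable f)
    {C : ℝ} (hC : ∀ x, |f x| ≤ C) (hpos : ∀ x, 0 < f x) :
    Integrable (fun x => f x ^ 2 * Real.log (f x)) μ := by
  refine Integrable.of_bound ((hm.pow_const 2).mul hm.log).aestronglyMeasurable (C ^ 2 * |Real.log C| + 1)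
    (Eventually.of_forall fun x => ?_)
  rw [Real.norm_eq_abs]
  exact abs_sq_mul_log_le (hpos x) (le_trans (le_abs_self _) (hC x))

/-- `f²` is integrable on a finite measure space for bounded measurable `f`. [cite: Martinelli1999, Proposition 3.10] -/
theorem integrable_sq_of_bound (μ : Measure Ω) [IsFiniteMeasure μ] {f : Ω → ℝ} (hm : Measurable f)
    {C : ℝ} (hC : ∀ x, |f x| ≤ C) : Integrable (fun x => f x ^ 2) μ := by
  refine Integrable.of_bound (hm.pow_const 2).aestronglyMeasurable (C ^ 2) (Eventually.of_forall fun x => ?_)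
  rw [Real.norm_eq_abs, abs_pow]
  exact pow_le_pow_left₀ (abs_nonneg _) (hC x) 2

/-- If almost every point is an atom of mass `≥ μ₀` of a probability measure, then `μ₀ ≤ 1`.
[cite: Martinelli1999, Proposition 3.10] -/
theorem atomMass_le_one (μ : Measure Ω) [IsProbabilityMeasure μ] {μ₀ : ℝ}
    (hatom : ∀ᵐ x ∂μ, μ₀ ≤ μ.real {x}) : μ₀ ≤ 1 := by
  haveI : (ae μ).NeBot := ae_neBot.2 (IsProbabilityMeasure.ne_zero μ)
  obtain ⟨x, hx⟩ := hatom.exists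
  exact hx.trans (measureReal_le_one)

/-- [Mar99] Prop 3.10 in normalised form: `μ` a probability measure, `h` bounded measurable positive with
`μ(h²) = 1` and `h ≤ M` a.s. (`M ≥ 1`); then `μ(h² log h) ≤ (4 + 4 log M) Var(h)`.
[cite: Martinelli1999, Proposition 3.10] -/
theorem integral_sq_mul_log_le_of_normalized (μ : Measure Ω) [IsProbabilityMeasure μ] {h : Ω → ℝ}
    (hm : Measurable h) {C : ℝ} (hC : ∀ x, |h x| ≤ C) (hpos : ∀ x, 0 < h x)
    (h1 : ∫ x, h x ^ 2 ∂μ = 1) {M : ℝ} (hM : 1 ≤ M) (hhM : ∀ᵐ x ∂μ, h x ≤ M) :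
    ∫ x, h x ^ 2 * Real.log (h x) ∂μ ≤ (4 + 4 * Real.log M) * Var[h; μ] := by
  have hC' : ∀ x, ‖h x‖ ≤ C := fun x => by rw [Real.norm_eq_abs]; exact hC x
  have hint : Integrable h μ := Integrable.of_bound hm.aestronglyMeasurable C (Eventually.of_forall hC')
  have hL2 : MemLp h 2 μ := MemLp.of_bound hm.aestronglyMeasurable C (Eventually.of_forall hC')
  set a := ∫ x, h x ∂μ with ha_def
  -- `0 < a ≤ 1`
  have ha : 0 < a := by
    rw [ha_def, integral_pos_iff_support_of_nonneg_ae (Eventually.of_forall fun x => (hpos x).le) hint]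
    have : Function.support h = Set.univ := by
      ext x; simp [(hpos x).ne']
    rw [this, measure_univ]; exact zero_lt_one
  have hvar : Var[h; μ] = (∫ x, (h ^ 2) x ∂μ) - a ^ 2 := by rw [ha_def]; exact variance_eq_sub hL2
  have hvar' : Var[h; μ] = 1 - a ^ 2 := by
    rw [hvar]; simp only [Pi.pow_apply]; rw [h1]
  have ha1 : a ≤ 1 := by
    have h0 : 0 ≤ Var[h; μ] := variance_nonneg h μ
    rw [hvar'] at h0
    nlinarith
  -- integrate the pointwise inequality
  set K := 4 + 4 * Real.log M with hK
  have hpt : ∀ᵐ x ∂μ, h x ^ 2 * Real.log (h x) ≤ a * (h x - a) + K * (h x - a) ^ 2 := by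
    filter_upwards [hhM] with x hx
    exact sq_mul_log_le_pointwise (hpos x) hx ha ha1 hM
  -- integrability of both sides (bounded measurable functions on a probability space)
  have hiL : Integrable (fun x => h x ^ 2 * Real.log (h x)) μ := integrable_sq_mul_log μ hm hC hpos
  have hi1 : Integrable (fun x => a * (h x - a)) μ := (hint.sub (integrable_const a)).const_mul a
  have hi2 : Integrable (fun x => K * (h x - a) ^ 2) μ := by
    refine Integrable.of_bound (((hm.sub measurable_const).pow_const 2).const_mul K).aestronglyMeasurable
      (|K| * (C + |a|) ^ 2) (Eventually.of_forall fun x => ?_)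
    have h1 : |h x - a| ≤ C + |a| := (abs_sub _ _).trans (add_le_add (hC x) le_rfl)
    rw [Real.norm_eq_abs, abs_mul, abs_pow]
    exact mul_le_mul_of_nonneg_left (pow_le_pow_left₀ (abs_nonneg _) h1 2) (abs_nonneg _)
  have hI1 : ∫ x, a * (h x - a) ∂μ = 0 := by
    rw [integral_const_mul, integral_sub hint (integrable_const a), integral_const]
    simp [ha_def]
  have hI2 : ∫ x, K * (h x - a) ^ 2 ∂μ = K * Var[h; μ] := by
    rw [integral_const_mul, variance_eq_integral hm.aemeasurable]
  calc ∫ x, h x ^ 2 * Real.log (h x) ∂μ ≤ ∫ x, (a * (h x - a) + K * (h x - a) ^ 2) ∂μ :=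
        integral_mono_ae hiL (hi1.add hi2) hpt
    _ = (∫ x, a * (h x - a) ∂μ) + ∫ x, K * (h x - a) ^ 2 ∂μ := integral_add hi1 hi2
    _ = K * Var[h; μ] := by rw [hI1, hI2, zero_add]

/-- **[Mar99] Proposition 3.10** (p0179 L16–21; proof p0179 L22 – p0180 L4), PROVED: let `μ` be a probability
measure almost all of whose points are atoms of mass at least `μ₀ > 0` (on a finite set: `μ₀ = inf_x μ(x)`).
Then for every bounded measurable positive `f`,
`μ(f² log f) ≤ (4 + 2 log μ₀⁻¹) Var(f) + μ(f²) log √μ(f²)`. [cite: Martinelli1999, Proposition 3.10] -/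
theorem Martinelli1999_prop3_10 [MeasurableSingletonClass Ω] (μ : Measure Ω) [IsProbabilityMeasure μ]
    {μ₀ : ℝ} (hμ₀ : 0 < μ₀) (hatom : ∀ᵐ x ∂μ, μ₀ ≤ μ.real {x}) {f : Ω → ℝ} (hm : Measurable f)
    {C : ℝ} (hC : ∀ x, |f x| ≤ C) (hpos : ∀ x, 0 < f x) :
    ∫ x, f x ^ 2 * Real.log (f x) ∂μ ≤
      (4 + 2 * Real.log μ₀⁻¹) * Var[f; μ] + (∫ x, f x ^ 2 ∂μ) * Real.log (Real.sqrt (∫ x, f x ^ 2 ∂μ)) := by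
  have hμ₀1 : μ₀ ≤ 1 := atomMass_le_one μ hatom
  have hint2 : Integrable (fun x => f x ^ 2) μ := integrable_sq_of_bound μ hm hC
  -- `m = μ(f²) > 0`, `s = √m`
  set m := ∫ x, f x ^ 2 ∂μ with hm_def
  have hm_pos : 0 < m := by
    rw [hm_def, integral_pos_iff_support_of_nonneg_ae (Eventually.of_forall fun x => sq_nonneg (f x)) hint2]
    have : Function.support (fun x => f x ^ 2) = Set.univ := by
      ext x; simp [(hpos x).ne']
    rw [this, measure_univ]; exact zero_lt_one
  set s := Real.sqrt m with hs_def
  have hs_pos : 0 < s := Real.sqrt_pos.2 hm_pos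
  have hs_sq : s ^ 2 = m := Real.sq_sqrt hm_pos.le
  -- the normalised function `h = f / s`
  set h : Ω → ℝ := fun x => s⁻¹ * f x with hh_def
  have hhm : Measurable h := hm.const_mul _
  have hhC : ∀ x, |h x| ≤ s⁻¹ * C := fun x => by
    rw [hh_def]; dsimp only; rw [abs_mul, abs_of_pos (inv_pos.2 hs_pos)]
    exact mul_le_mul_of_nonneg_left (hC x) (inv_pos.2 hs_pos).le
  have hhpos : ∀ x, 0 < h x := fun x => mul_pos (inv_pos.2 hs_pos) (hpos x)
  have hh1 : ∫ x, h x ^ 2 ∂μ = 1 := by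
    have : (fun x => h x ^ 2) = fun x => (s ^ 2)⁻¹ * f x ^ 2 := by
      funext x; rw [hh_def]; dsimp only; rw [mul_pow, inv_pow]
    rw [this, integral_const_mul, hs_sq, ← hm_def, inv_mul_cancel₀ hm_pos.ne']
  -- a.e. bound `h ≤ M = √(μ₀⁻¹)`: `f(x)² μ₀ ≤ f(x)² μ{x} ≤ μ(f²) = m`
  set M := Real.sqrt μ₀⁻¹ with hM_def
  have hM1 : 1 ≤ M := by
    rw [hM_def, Real.le_sqrt' one_pos, one_pow]
    exact one_le_inv_iff₀.2 ⟨hμ₀, hμ₀1⟩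
  have hhM : ∀ᵐ x ∂μ, h x ≤ M := by
    filter_upwards [hatom] with x hx
    have h1 : ∫ y in {x}, f y ^ 2 ∂μ ≤ m :=
      setIntegral_le_integral hint2 (Eventually.of_forall fun y => sq_nonneg (f y))
    rw [integral_singleton, smul_eq_mul] at h1
    have h2 : μ₀ * f x ^ 2 ≤ m := (mul_le_mul_of_nonneg_right hx (sq_nonneg _)).trans h1
    have h3 : h x ^ 2 ≤ μ₀⁻¹ := by
      rw [hh_def]; dsimp only; rw [mul_pow, inv_pow, hs_sq]
      rw [inv_mul_le_iff₀ hm_pos, le_mul_inv_iff₀ hμ₀]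
      linarith
    calc h x = Real.sqrt (h x ^ 2) := (Real.sqrt_sq (hhpos x).le).symm
      _ ≤ Real.sqrt μ₀⁻¹ := Real.sqrt_le_sqrt h3
  -- the normalised inequality
  have key := integral_sq_mul_log_le_of_normalized μ hhm hhC hhpos hh1 hM1 hhM
  -- `4 + 4 log M = 4 + 2 log μ₀⁻¹`
  have hK : 4 + 4 * Real.log M = 4 + 2 * Real.log μ₀⁻¹ := by
    rw [hM_def, Real.log_sqrt (inv_nonneg.2 hμ₀.le)]; ring
  rw [hK] at key
  -- undo the normalisation: `∫ h² log h = m⁻¹ ∫ f² log f − log s`, `Var h = m⁻¹ Var f`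
  have hVar : Var[h; μ] = (s⁻¹) ^ 2 * Var[f; μ] := by rw [hh_def]; exact variance_const_mul _ _ _
  have hI : ∫ x, h x ^ 2 * Real.log (h x) ∂μ = m⁻¹ * ∫ x, f x ^ 2 * Real.log (f x) ∂μ - Real.log s := by
    have hpt : ∀ x, h x ^ 2 * Real.log (h x) =
        m⁻¹ * (f x ^ 2 * Real.log (f x)) - Real.log s * m⁻¹ * f x ^ 2 := by
      intro x
      rw [hh_def]; dsimp only
      rw [Real.log_mul (inv_pos.2 hs_pos).ne' (hpos x).ne', Real.log_inv, mul_pow, inv_pow, hs_sq]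
      ring
    simp_rw [hpt]
    rw [integral_sub ((integrable_sq_mul_log μ hm hC hpos).const_mul _) (hint2.const_mul _),
      integral_const_mul, integral_const_mul, ← hm_def, mul_assoc, inv_mul_cancel₀ hm_pos.ne', mul_one]
  rw [hI, hVar] at key
  -- multiply through by `m = s²`
  have hs2inv : (s⁻¹) ^ 2 = m⁻¹ := by rw [inv_pow, hs_sq]
  rw [hs2inv] at key
  have key2 := mul_le_mul_of_nonneg_left key hm_pos.le
  rw [mul_sub, ← mul_assoc, ← mul_assoc, mul_inv_cancel₀ hm_pos.ne', one_mul, mul_comm m (4 + _),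
    mul_assoc, mul_inv_cancel_left₀ hm_pos.ne'] at key2
  linarith

/-- **[Mar99] Proposition 3.9, abstract form** (p0179 L10–15: `c_s(L_Λ^τ) ≤ [4 + (4‖J‖ + 2 log 2)|Λ|]
gap(L_Λ^τ)⁻¹`, «follows from (3.12), Proposition 3.10, and a trivial estimate on `inf_σ μ_Λ^τ(σ)`»), PROVED in the
form: a Poincaré inequality with constant `g > 0` for a probability measure whose atoms have mass `≥ μ₀` a.s.
gives the log-Sobolev inequality with constant `(4 + 2 log μ₀⁻¹)/g`.  For `ν = μ_Λ^τ` the trivial estimate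
`μ_Λ^τ(σ) ≥ 2^{−|Λ|} e^{−2‖J‖|Λ|}` yields the printed constant. [cite: Martinelli1999, Proposition 3.9] -/
theorem Martinelli1999_prop3_9 {d : ℕ} (ν : Measure (Site d → ℤˣ)) [IsProbabilityMeasure ν]
    (V : Finset (Site d)) {μ₀ : ℝ} (hμ₀ : 0 < μ₀) (hatom : ∀ᵐ σ ∂ν, μ₀ ≤ ν.real {σ}) {g : ℝ}
    (hg : 0 < g) (hP : PoincareIneq ν V g) :
    LogSobolevIneq ν V ((4 + 2 * Real.log μ₀⁻¹) / g) := by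
  intro f hf hbdd hpos
  obtain ⟨C, hC⟩ := hbdd
  have h310 := Martinelli1999_prop3_10 ν hμ₀ hatom hf hC hpos
  have hPf : g * Var[f; ν] ≤ dirichletForm ν V f := hP f hf ⟨C, hC⟩
  have hK : 0 ≤ 4 + 2 * Real.log μ₀⁻¹ := by
    have : 0 ≤ Real.log μ₀⁻¹ := Real.log_nonneg (one_le_inv_iff₀.2 ⟨hμ₀, atomMass_le_one ν hatom⟩)
    linarith
  have hstep : (4 + 2 * Real.log μ₀⁻¹) * Var[f; ν] ≤ (4 + 2 * Real.log μ₀⁻¹) / g * dirichletForm ν V f := by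
    rw [div_mul_eq_mul_div, le_div_iff₀ hg, mul_assoc]
    exact mul_le_mul_of_nonneg_left (by rw [mul_comm]; exact hPf) hK
  linarith

/-! ### Proposition 3.11: comparison of log-Sobolev constants under bounded density ratios -/

/-- **[Mar99] Proposition 3.11** (p0180 L1–12, after Holley–Stroock [HS]), PROVED: if two probability
measures satisfy `ν₁ ≤ ε ν₂` and `ν₂ ≤ ε ν₁` (the printed `‖dν₁/dν₂‖_∞ ∨ ‖dν₂/dν₁‖_∞ ≤ ε`), then
`c_s(ν₁) ≤ ε² c_s(ν₂)`: a log-Sobolev inequality for `ν₂` with constant `c ≥ 0` gives one for `ν₁` with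
constant `ε² c`.  Proof as printed: `Ent_{ν₁}(f²) = min_{a>0} ν₁(f² log f² − f² log a − f² + a)` with a
nonnegative integrand, `≤ ε` times the same integral under `ν₂` at `a = ν₂(f²)`, `= 2ε Ent_{ν₂}`, and
`ν₂(|∇_V f|²) ≤ ε ν₁(|∇_V f|²)`. [cite: Martinelli1999, Proposition 3.11] -/
theorem Martinelli1999_prop3_11 {d : ℕ} {ν₁ ν₂ : Measure (Site d → ℤˣ)} [IsProbabilityMeasure ν₁]
    [IsProbabilityMeasure ν₂] {ε : NNReal} (h12 : ν₁ ≤ ε • ν₂) (h21 : ν₂ ≤ ε • ν₁) {V : Finset (Site d)}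
    {c : ℝ} (hc : 0 ≤ c) (h : LogSobolevIneq ν₂ V c) : LogSobolevIneq ν₁ V ((ε : ℝ) ^ 2 * c) := by
  intro f hf hbdd hpos
  obtain ⟨C, hC⟩ := hbdd
  have hε : 0 ≤ (ε : ℝ) := ε.coe_nonneg
  -- the quantities
  set b₁ := ∫ σ, f σ ^ 2 ∂ν₁ with hb₁
  set a₂ := ∫ σ, f σ ^ 2 ∂ν₂ with ha₂
  have hint1 : Integrable (fun σ => f σ ^ 2) ν₁ := integrable_sq_of_bound ν₁ hf hC
  have hint2 : Integrable (fun σ => f σ ^ 2) ν₂ := integrable_sq_of_bound ν₂ hf hC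
  have hL1 : Integrable (fun σ => f σ ^ 2 * Real.log (f σ)) ν₁ := integrable_sq_mul_log ν₁ hf hC hpos
  have hL2 : Integrable (fun σ => f σ ^ 2 * Real.log (f σ)) ν₂ := integrable_sq_mul_log ν₂ hf hC hpos
  have hpos_int : ∀ (ν : Measure (Site d → ℤˣ)) [IsProbabilityMeasure ν], 0 < ∫ σ, f σ ^ 2 ∂ν := by
    intro ν _
    rw [integral_pos_iff_support_of_nonneg_ae (Eventually.of_forall fun x => sq_nonneg (f x))
      (integrable_sq_of_bound ν hf hC)]
    have : Function.support (fun x => f x ^ 2) = Set.univ := by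
      ext x; simp [(hpos x).ne']
    rw [this, measure_univ]; exact zero_lt_one
  have hb₁pos : 0 < b₁ := hpos_int ν₁
  have ha₂pos : 0 < a₂ := hpos_int ν₂
  -- the nonnegative integrand `φ(f²) = f² log f² − f² log a₂ − f² + a₂ = 2 f² log f − f² log a₂ − f² + a₂`
  set φ : (Site d → ℤˣ) → ℝ := fun σ => 2 * (f σ ^ 2 * Real.log (f σ)) - Real.log a₂ * f σ ^ 2 - f σ ^ 2 + a₂
    with hφ
  have hφ_nonneg : ∀ σ, 0 ≤ φ σ := by
    intro σ
    have := mul_log_sub_nonneg ha₂pos (sq_nonneg (f σ))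
    have hlog2 : Real.log (f σ ^ 2) = 2 * Real.log (f σ) := by
      rw [Real.log_pow]; norm_num
    rw [hlog2] at this
    rw [hφ]; dsimp only; linarith
  have hφ_int : ∀ (ν : Measure (Site d → ℤˣ)) [IsProbabilityMeasure ν], Integrable φ ν := by
    intro ν _
    exact ((((integrable_sq_mul_log ν hf hC hpos).const_mul 2).sub
      ((integrable_sq_of_bound ν hf hC).const_mul _)).sub (integrable_sq_of_bound ν hf hC)).add
      (integrable_const _)
  have hφ_val : ∀ (ν : Measure (Site d → ℤˣ)) [IsProbabilityMeasure ν],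
      ∫ σ, φ σ ∂ν = 2 * ∫ σ, f σ ^ 2 * Real.log (f σ) ∂ν - Real.log a₂ * (∫ σ, f σ ^ 2 ∂ν) -
        (∫ σ, f σ ^ 2 ∂ν) + a₂ := by
    intro ν _
    rw [hφ]; dsimp only
    rw [integral_add _ (integrable_const _), integral_sub, integral_sub, integral_const_mul,
      integral_const_mul, integral_const]
    · simp
    · exact ((integrable_sq_mul_log ν hf hC hpos).const_mul 2)
    · exact ((integrable_sq_of_bound ν hf hC).const_mul _)
    · exact (((integrable_sq_mul_log ν hf hC hpos).const_mul 2).sub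
        ((integrable_sq_of_bound ν hf hC).const_mul _))
    · exact integrable_sq_of_bound ν hf hC
    · exact ((((integrable_sq_mul_log ν hf hC hpos).const_mul 2).sub
        ((integrable_sq_of_bound ν hf hC).const_mul _)).sub (integrable_sq_of_bound ν hf hC))
  -- Step A: `Ent₁ ≤ ½ ν₁(φ)` (the variational characterisation, at the non-optimal `a = a₂`)
  have hA : ∫ σ, f σ ^ 2 * Real.log (f σ) ∂ν₁ - b₁ * Real.log (Real.sqrt b₁) ≤ (1 / 2) * ∫ σ, φ σ ∂ν₁ := by
    rw [hφ_val ν₁, ← hb₁, Real.log_sqrt hb₁pos.le]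
    have := mul_log_sub_nonneg ha₂pos hb₁pos.le
    linarith
  -- Step B: `ν₁(φ) ≤ ε ν₂(φ)`
  have hB : ∫ σ, φ σ ∂ν₁ ≤ (ε : ℝ) * ∫ σ, φ σ ∂ν₂ := by
    have h1 : ∫ σ, φ σ ∂ν₁ ≤ ∫ σ, φ σ ∂(ε • ν₂) :=
      integral_mono_measure h12 (Eventually.of_forall hφ_nonneg) ((hφ_int ν₂).smul_measure_nnreal (c := ε))
    rwa [integral_smul_nnreal_measure] at h1
  -- Step C: `½ ν₂(φ) = Ent₂ ≤ c 𝓔₂(f)`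
  have hCstep : (1 / 2) * ∫ σ, φ σ ∂ν₂ ≤ c * dirichletForm ν₂ V f := by
    have hEnt2 := h f hf ⟨C, hC⟩ hpos
    rw [hφ_val ν₂, ← ha₂, Real.log_sqrt ha₂pos.le] at *
    linarith
  -- Step D: `𝓔₂(f) ≤ ε 𝓔₁(f)`
  have hD : dirichletForm ν₂ V f ≤ (ε : ℝ) * dirichletForm ν₁ V f := by
    unfold dirichletForm
    have hgi : Integrable (gradSq V f) ν₁ :=
      Integrable.of_bound (measurable_gradSq V hf).aestronglyMeasurable (4 * V.card * C ^ 2)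
        (Eventually.of_forall fun σ => by
          rw [Real.norm_eq_abs, abs_of_nonneg (gradSq_nonneg _ _ _)]; exact gradSq_le V hC σ)
    have h1 : ∫ σ, gradSq V f σ ∂ν₂ ≤ ∫ σ, gradSq V f σ ∂(ε • ν₁) :=
      integral_mono_measure h21 (Eventually.of_forall (gradSq_nonneg V f)) (hgi.smul_measure_nnreal (c := ε))
    rw [integral_smul_nnreal_measure] at h1
    calc (1 / 2) * ∫ σ, gradSq V f σ ∂ν₂ ≤ (1 / 2) * ((ε : ℝ) • ∫ σ, gradSq V f σ ∂ν₁) :=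
          mul_le_mul_of_nonneg_left h1 (by norm_num)
      _ = (ε : ℝ) * ((1 / 2) * ∫ σ, gradSq V f σ ∂ν₁) := by rw [smul_eq_mul]; ring
  -- combine
  have hφ2_nonneg : 0 ≤ ∫ σ, φ σ ∂ν₂ := integral_nonneg hφ_nonneg
  calc ∫ σ, f σ ^ 2 * Real.log (f σ) ∂ν₁
      ≤ (1 / 2) * ∫ σ, φ σ ∂ν₁ + b₁ * Real.log (Real.sqrt b₁) := by linarith
    _ ≤ (ε : ℝ) * ((1 / 2) * ∫ σ, φ σ ∂ν₂) + b₁ * Real.log (Real.sqrt b₁) := by nlinarith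
    _ ≤ (ε : ℝ) * (c * dirichletForm ν₂ V f) + b₁ * Real.log (Real.sqrt b₁) := by
        nlinarith
    _ ≤ (ε : ℝ) * (c * ((ε : ℝ) * dirichletForm ν₁ V f)) + b₁ * Real.log (Real.sqrt b₁) := by
        nlinarith [mul_nonneg hε hc]
    _ = (ε : ℝ) ^ 2 * c * dirichletForm ν₁ V f + b₁ * Real.log (Real.sqrt b₁) := by ring

/-! ### The log-Sobolev inequality implies the Poincaré inequality: `gap ≥ c_s⁻¹` -/

/-- Third-order Taylor bound for `(1+u)² log(1+u)` at `0`: for `|u| ≤ ½`,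
`(1+u)² log(1+u) ≥ u + (3/2) u² − 6|u|³` (from Mathlib's remainder estimate for the logarithmic series,
`|−u + u²/2 + log(1+u)| ≤ |u|³/(1 − |u|)`). [cite: Martinelli1999, Theorem 3.3] -/
theorem sq_mul_log_one_add_ge {u : ℝ} (hu : |u| ≤ 1 / 2) :
    u + 3 / 2 * u ^ 2 - 6 * |u| ^ 3 ≤ (1 + u) ^ 2 * Real.log (1 + u) := by
  have hu1 : |(-u)| < 1 := by rw [abs_neg]; linarith
  have h := Real.abs_log_sub_add_sum_range_le hu1 2
  simp only [Finset.sum_range_succ, Finset.sum_range_zero, zero_add, sub_neg_eq_add, abs_neg] at h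
  norm_num at h
  -- `h : |-u + u^2/2 + log (1+u)| ≤ |u|^3 / (1 - |u|)`
  set r := Real.log (1 + u) - (u - u ^ 2 / 2) with hr
  have habs : |r| ≤ 2 * |u| ^ 3 := by
    have h1 : |r| ≤ |u| ^ 3 / (1 - |u|) := by
      have : r = -u + u ^ 2 / 2 + Real.log (1 + u) := by rw [hr]; ring
      rw [this]; exact h
    have h2 : |u| ^ 3 / (1 - |u|) ≤ 2 * |u| ^ 3 := by
      rw [div_le_iff₀ (by linarith)]
      nlinarith [abs_nonneg u, pow_nonneg (abs_nonneg u) 3]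
    exact h1.trans h2
  have hlog : Real.log (1 + u) = u - u ^ 2 / 2 + r := by rw [hr]; ring
  rw [hlog]
  have hsq0 : 0 ≤ (1 + u) ^ 2 := sq_nonneg _
  have hsq : (1 + u) ^ 2 ≤ 9 / 4 := by
    have : |1 + u| ≤ 3 / 2 := by
      calc |1 + u| ≤ |1| + |u| := abs_add_le _ _
        _ ≤ 3 / 2 := by rw [abs_one]; linarith
    calc (1 + u) ^ 2 = |1 + u| ^ 2 := (sq_abs _).symm
      _ ≤ (3 / 2) ^ 2 := pow_le_pow_left₀ (abs_nonneg _) this 2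
      _ = 9 / 4 := by norm_num
  have hr_lower : -(2 * |u| ^ 3) ≤ r := (abs_le.1 habs).1
  have hu3 : 0 ≤ |u| ^ 3 := pow_nonneg (abs_nonneg u) 3
  have hprod : -(9 / 4 * (2 * |u| ^ 3)) ≤ (1 + u) ^ 2 * r := by
    have h1 : (1 + u) ^ 2 * (-(2 * |u| ^ 3)) ≤ (1 + u) ^ 2 * r := mul_le_mul_of_nonneg_left hr_lower hsq0
    have h2 : -(9 / 4 * (2 * |u| ^ 3)) ≤ (1 + u) ^ 2 * (-(2 * |u| ^ 3)) := by nlinarith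
    exact h2.trans h1
  have hu4 : u ^ 4 ≤ |u| ^ 3 / 2 := by
    have : u ^ 4 = |u| ^ 3 * |u| := by
      rw [show u ^ 4 = |u| ^ 4 by rw [pow_abs, abs_of_nonneg (by positivity)]]; ring
    rw [this]; nlinarith
  nlinarith

/-- `∇_x` kills additive constants. [cite: Martinelli1999, §2.1] -/
theorem siteGrad_sub_const {d : ℕ} (x : Site d) (f : (Site d → ℤˣ) → ℝ) (m : ℝ) (σ : Site d → ℤˣ) :
    siteGrad x (fun τ => f τ - m) σ = siteGrad x f σ := by
  unfold siteGrad; ring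

/-- `∇_x (1 + ε g) = ε ∇_x g`. [cite: Martinelli1999, §2.1] -/
theorem siteGrad_const_add_mul {d : ℕ} (x : Site d) (g : (Site d → ℤˣ) → ℝ) (ε : ℝ) (σ : Site d → ℤˣ) :
    siteGrad x (fun τ => 1 + ε * g τ) σ = ε * siteGrad x g σ := by
  unfold siteGrad; ring

/-- **Log-Sobolev implies Poincaré**, `gap(L_V^τ) ≥ c_s(L_V^τ)⁻¹` ([Mar99] p0171 L31–33 «a well known result (see e.g
[SC])», used in the proof of Theorem 3.3; Bauerschmidt–Bodineau–Dagallier Prop. 2: «applying the log-Sobolev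
inequality to the test function `1 + εF` and then letting `ε` tend to `0`»), PROVED for a probability measure:
`LogSobolevIneq ν V c` with `c > 0` implies `PoincareIneq ν V c⁻¹`.  Proof: for `g = f − ν(f)` and small `ε`,
the log-Sobolev inequality for `1 + εg` reads `(3/2)ε² Var f − O(ε³) ≤ c ε² 𝓔(f) + ½ ε² Var f + O(ε⁴)`.
[cite: Martinelli1999, Theorem 3.3] -/
theorem LogSobolevIneq.poincareIneq {d : ℕ} {ν : Measure (Site d → ℤˣ)} [IsProbabilityMeasure ν]
    {V : Finset (Site d)} {c : ℝ} (hc : 0 < c) (h : LogSobolevIneq ν V c) : PoincareIneq ν V c⁻¹ := by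
  intro f hf hbdd
  obtain ⟨C, hC⟩ := hbdd
  rw [inv_mul_le_iff₀ hc]
  have hC0 : 0 ≤ C := (abs_nonneg _).trans (hC (fun _ => 1))
  -- bounded measurable functions are integrable
  have ibdd : ∀ (φ : (Site d → ℤˣ) → ℝ) (K : ℝ), Measurable φ → (∀ σ, |φ σ| ≤ K) → Integrable φ ν :=
    fun φ K hφ hK => Integrable.of_bound hφ.aestronglyMeasurable K
      (Eventually.of_forall fun σ => by rw [Real.norm_eq_abs]; exact hK σ)
  have hfi : Integrable f ν := ibdd f C hf hC
  -- the centred function `g = f − ν(f)`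
  set m := ∫ σ, f σ ∂ν with hm
  have hmC : |m| ≤ C := by
    rw [hm]
    calc |∫ σ, f σ ∂ν| ≤ ∫ σ, |f σ| ∂ν := abs_integral_le_integral_abs
      _ ≤ ∫ _σ, C ∂ν := integral_mono hfi.abs (integrable_const C) hC
      _ = C := by simp
  set g : (Site d → ℤˣ) → ℝ := fun σ => f σ - m with hg
  have hgm : Measurable g := hf.sub measurable_const
  set B := 2 * C + 1 with hB
  have hB0 : 0 < B := by rw [hB]; linarith
  have hB1 : 1 ≤ B := by rw [hB]; linarith
  have hgB : ∀ σ, |g σ| ≤ B := fun σ => by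
    rw [hg]; dsimp only
    calc |f σ - m| ≤ |f σ| + |m| := abs_sub _ _
      _ ≤ C + C := add_le_add (hC σ) hmC
      _ ≤ B := by rw [hB]; linarith
  have hgi : Integrable g ν := ibdd g B hgm hgB
  have hg0 : ∫ σ, g σ ∂ν = 0 := by
    rw [hg]; dsimp only
    rw [integral_sub hfi (integrable_const m), integral_const]; simp [hm]
  set Vr := Var[f; ν] with hVr
  have hVarg : Vr = ∫ σ, g σ ^ 2 ∂ν := by rw [hVr, variance_eq_integral hf.aemeasurable]
  have hVr0 : 0 ≤ Vr := variance_nonneg f ν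
  set E := dirichletForm ν V f with hEdef
  have hg2i : Integrable (fun σ => g σ ^ 2) ν := integrable_sq_of_bound ν hgm hgB
  -- the key inequality for small `ε`
  have key : ∀ ε : ℝ, 0 < ε → ε ≤ 1 / (2 * B) → Vr ≤ c * E + 6 * ε * B ^ 3 + 1 / 2 * ε ^ 2 * Vr ^ 2 := by
    intro ε hε hεB
    have hεB' : ε * B ≤ 1 / 2 := by
      have h' := hεB
      rw [le_div_iff₀ (by linarith)] at h'
      linarith
    -- the test function `1 + ε g`
    set fe : (Site d → ℤˣ) → ℝ := fun σ => 1 + ε * g σ with hfe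
    have hu : ∀ σ, |ε * g σ| ≤ 1 / 2 := fun σ => by
      rw [abs_mul, abs_of_pos hε]
      exact (mul_le_mul_of_nonneg_left (hgB σ) hε.le).trans hεB'
    have hfe_pos : ∀ σ, 0 < fe σ := fun σ => by
      rw [hfe]; dsimp only; have := (abs_le.1 (hu σ)).1; linarith
    have hfe_m : Measurable fe := measurable_const.add (hgm.const_mul ε)
    have hfe_bd : ∀ σ, |fe σ| ≤ 3 / 2 := fun σ => by
      rw [hfe]; dsimp only
      calc |1 + ε * g σ| ≤ |1| + |ε * g σ| := abs_add_le _ _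
        _ ≤ 3 / 2 := by rw [abs_one]; linarith [hu σ]
    have hLSI := h fe hfe_m ⟨3 / 2, hfe_bd⟩ hfe_pos
    -- `∫ fe² = 1 + ε² Vr`
    have hfe2 : ∫ σ, fe σ ^ 2 ∂ν = 1 + ε ^ 2 * Vr := by
      have hpt : ∀ σ, fe σ ^ 2 = 1 + ((2 * ε) * g σ + ε ^ 2 * g σ ^ 2) := fun σ => by
        show (1 + ε * g σ) ^ 2 = _; ring
      simp_rw [hpt]
      rw [integral_add (f := fun _ => (1 : ℝ)) (g := fun σ => (2 * ε) * g σ + ε ^ 2 * g σ ^ 2)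
        (integrable_const _) ((hgi.const_mul _).add (hg2i.const_mul _))]
      rw [integral_add (f := fun σ => (2 * ε) * g σ) (g := fun σ => ε ^ 2 * g σ ^ 2)
        (hgi.const_mul _) (hg2i.const_mul _), integral_const_mul, integral_const_mul, hg0, ← hVarg,
        integral_const]
      simp
    -- `𝓔(fe) = ε² E`
    have hEfe : dirichletForm ν V fe = ε ^ 2 * E := by
      have hgrad : ∀ σ, gradSq V fe σ = ε ^ 2 * gradSq V f σ := by
        intro σ
        simp only [gradSq, Finset.mul_sum]
        refine Finset.sum_congr rfl fun x _ => ?_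
        rw [show fe = fun τ => 1 + ε * g τ from rfl, siteGrad_const_add_mul,
          show g = fun τ => f τ - m from rfl, siteGrad_sub_const]
        ring
      rw [hEdef]; unfold dirichletForm
      simp_rw [hgrad]
      rw [integral_const_mul]; ring
    -- the right-hand side: `(1+ε²V) log √(1+ε²V) ≤ ½ (1+ε²V) ε² V`
    have hx0 : 0 ≤ ε ^ 2 * Vr := mul_nonneg (sq_nonneg ε) hVr0
    have hRHS : (1 + ε ^ 2 * Vr) * Real.log (Real.sqrt (1 + ε ^ 2 * Vr)) ≤
        1 / 2 * (1 + ε ^ 2 * Vr) * (ε ^ 2 * Vr) := by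
      rw [Real.log_sqrt (by linarith)]
      have hl : Real.log (1 + ε ^ 2 * Vr) ≤ ε ^ 2 * Vr := by
        have := Real.log_le_sub_one_of_pos (show 0 < 1 + ε ^ 2 * Vr by linarith); linarith
      have := mul_le_mul_of_nonneg_left hl (show 0 ≤ 1 + ε ^ 2 * Vr by linarith)
      nlinarith
    -- the left-hand side: `∫ fe² log fe ≥ (3/2) ε² Vr − 6 ε³ B³`
    have hlow_pt : ∀ σ, ε * g σ + 3 / 2 * (ε ^ 2 * g σ ^ 2) - 6 * (ε ^ 3 * B ^ 3) ≤
        fe σ ^ 2 * Real.log (fe σ) := by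
      intro σ
      have h1 := sq_mul_log_one_add_ge (hu σ)
      have hle : |ε * g σ| ≤ ε * B := by
        rw [abs_mul, abs_of_pos hε]; exact mul_le_mul_of_nonneg_left (hgB σ) hε.le
      have h2 : |ε * g σ| ^ 3 ≤ ε ^ 3 * B ^ 3 := by
        calc |ε * g σ| ^ 3 ≤ (ε * B) ^ 3 := pow_le_pow_left₀ (abs_nonneg _) hle 3
          _ = ε ^ 3 * B ^ 3 := by ring
      have hfeσ : fe σ = 1 + ε * g σ := rfl
      rw [hfeσ]
      have h3 : (ε * g σ) ^ 2 = ε ^ 2 * g σ ^ 2 := by ring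
      rw [h3] at h1
      linarith
    have hlow_i : Integrable (fun σ => ε * g σ + 3 / 2 * (ε ^ 2 * g σ ^ 2) - 6 * (ε ^ 3 * B ^ 3)) ν :=
      ((hgi.const_mul ε).add ((hg2i.const_mul _).const_mul _)).sub (integrable_const _)
    have hfeL : Integrable (fun σ => fe σ ^ 2 * Real.log (fe σ)) ν :=
      integrable_sq_mul_log ν hfe_m hfe_bd hfe_pos
    have hlow_val : ∫ σ, (ε * g σ + 3 / 2 * (ε ^ 2 * g σ ^ 2) - 6 * (ε ^ 3 * B ^ 3)) ∂ν =
        3 / 2 * ε ^ 2 * Vr - 6 * ε ^ 3 * B ^ 3 := by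
      rw [integral_sub (f := fun σ => ε * g σ + 3 / 2 * (ε ^ 2 * g σ ^ 2)) (g := fun _ => 6 * (ε ^ 3 * B ^ 3))
        ((hgi.const_mul ε).add ((hg2i.const_mul _).const_mul _)) (integrable_const _)]
      rw [integral_add (f := fun σ => ε * g σ) (g := fun σ => 3 / 2 * (ε ^ 2 * g σ ^ 2))
        (hgi.const_mul ε) ((hg2i.const_mul _).const_mul _)]
      rw [integral_const_mul, integral_const_mul, integral_const_mul, hg0, ← hVarg, integral_const]
      simp; ring
    have hLHS : 3 / 2 * ε ^ 2 * Vr - 6 * ε ^ 3 * B ^ 3 ≤ ∫ σ, fe σ ^ 2 * Real.log (fe σ) ∂ν := by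
      rw [← hlow_val]; exact integral_mono hlow_i hfeL hlow_pt
    -- combine
    rw [hEfe, hfe2] at hLSI
    have hcomb : 3 / 2 * ε ^ 2 * Vr - 6 * ε ^ 3 * B ^ 3 ≤
        c * (ε ^ 2 * E) + 1 / 2 * (1 + ε ^ 2 * Vr) * (ε ^ 2 * Vr) := by linarith
    -- divide by `ε²`
    have hε2 : 0 < ε ^ 2 := pow_pos hε 2
    have : ε ^ 2 * Vr ≤ ε ^ 2 * (c * E + 6 * ε * B ^ 3 + 1 / 2 * ε ^ 2 * Vr ^ 2) := by nlinarith
    exact le_of_mul_le_mul_left this hε2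
  -- let `ε → 0`
  refine le_of_forall_pos_le_add fun η hη => ?_
  set ε := min (1 / (2 * B)) (η / (6 * B ^ 3 + 1 / 2 * Vr ^ 2 + 1)) with hε
  have hD : 0 < 6 * B ^ 3 + 1 / 2 * Vr ^ 2 + 1 := by positivity
  have hεpos : 0 < ε := lt_min (by positivity) (div_pos hη hD)
  have hε1 : ε ≤ 1 / (2 * B) := min_le_left _ _
  have hε2 : ε ≤ η / (6 * B ^ 3 + 1 / 2 * Vr ^ 2 + 1) := min_le_right _ _
  have hεle1 : ε ≤ 1 := hε1.trans (by rw [div_le_one (by linarith)]; linarith)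
  have hk := key ε hεpos hε1
  have hsmall : 6 * ε * B ^ 3 + 1 / 2 * ε ^ 2 * Vr ^ 2 ≤ η := by
    have h1 : ε ^ 2 ≤ ε := by nlinarith
    have h2 : 6 * ε * B ^ 3 + 1 / 2 * ε ^ 2 * Vr ^ 2 ≤ ε * (6 * B ^ 3 + 1 / 2 * Vr ^ 2 + 1) := by
      nlinarith [sq_nonneg Vr, pow_pos hB0 3]
    have h3 : ε * (6 * B ^ 3 + 1 / 2 * Vr ^ 2 + 1) ≤ η := by
      rwa [le_div_iff₀ hD] at hε2
    linarith
  linarith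

end Glauber

end Literature.Probability.LatticeModels

end
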